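import Summits.Langlands.Langlands.Statement
import Summits.Langlands.Langlands.Theorems.DyadicOddResidueOddPrimesRegularFMOfXZhang
import HarnessLib

/-!
# Witness (F3 / BC5) for the rung `OddRegularGaloisToAutomorphicQ 3` of line
# `OddRegularGaloisToAutomorphicQ3` (crux `ReciprocityUpToIrreducibility`, item stmt-Langlands-14328)

The rung family `OddRegularGaloisToAutomorphicQ n` (VERBATIM the definition in
`Lines/OddRegularGaloisToAutomorphicQ3.lean`) SPECIALISES at the floor parameter `n = 2` to the tree
theorem `Summit.Langlands.Langlands.Theorems.oddPrimesRegularFM_of_XZhang2024_tateTwist`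
(`Theorems/DyadicOddResidueOddPrimesRegularFMOfXZhang.lean`; item `DyadicOddResidue.OddPrimesRegularFM`,
stmt-Langlands-18743): Fontaine–Mazur for `GL₂/ℚ` in the regular case at every odd prime — Kisin 2009
(Thm. of the Introduction), Emerton 2011, Skinner–Wiles 1999, Hu–Tan 2015, Pan 2022 (JAMS 35,
Thm. 1.0.4), X. Zhang 2024 (arXiv:2412.06812, Thm. 1.0.2), with Khare–Wintenberger — conditional on
exactly the one named Literature fact `XZhang2024_fontaineMazurGL2_tateTwist`, which the example below
carries as its hypothesis; NO `sorry`.  The only conversion is parity: the family states oddness in the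
rank-uniform Caraiani–Le Hung form `tr ρ(c) ∈ {0, 1, -1}`, which at `n = 2` is Serre's `det ρ(c) = -1`
(`isOdd_of_trace`, Cayley–Hamilton for a `2 × 2` involution).
witness_regime: n = 2, F = ℚ, ℓ odd, ρ irreducible odd, de Rham with distinct Hodge–Tate weights.
S known there: the (B)-clause of S on exactly this cell IS the floor theorem (F9: literal
specialisation); S as a whole is not known at n = 2 over ℚ (even ρ: Calegari 2011/2012 only under
hypotheses; ℓ = 2: open in the residually dihedral/Eisenstein cases; full `Corresponds` at v = ℓ).
Calibration OUTSIDE S's known regime inside the rung n = 3: the essentially self-dual odd cell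
(ρ ≅ Sym² σ ⊗ η, σ odd regular: automorphic by the floor + Gelbart–Jacquet, tree named fact
`GelbartJacquet_symmSq_automorphic`) is decided while (B) for GL₃/ℚ is open.
-/

noncomputable section

set_option linter.dupNamespace false

open scoped MatrixGroups Matrix NumberField Classical Polynomial
open Filter IsDedekindDomain Field Polynomial
open Literature.NumberTheory.Automorphic Literature.NumberTheory.GaloisRepresentations
open Literature.NumberTheory.PAdicHodge
open Summit.Langlands

namespace Summit.Langlands.Langlands.Cruxes.ReciprocityUpToIrreducibility.OddRegularGaloisToAutomorphicQ3.Special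

/-- **The rung family** (dial = rank `n`): clause (B) over `ℚ` on the Fontaine–Mazur sector at odd `ℓ`,
Caraiani–Le Hung parity, a.e.-Satake conclusion.  At `n = 2` it is (equivalent to, `floor_two`) the
tree item `DyadicOddResidue.OddPrimesRegularFM`. -/
def OddRegularGaloisToAutomorphicQ (n : ℕ) : Prop :=
  ∀ (ℓ : ℕ) [Fact ℓ.Prime], ℓ ≠ 2 →
    ∀ (ρ : Literature.NumberTheory.GaloisRepresentations.FramedGaloisRep ℚ (PadicAlgCl ℓ) n),
      ρ.toGaloisRep.IsIrreducible →
      (∀ (φ : ℚ →+* ℝ) (c : Field.absoluteGaloisGroup ℚ),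
        Literature.NumberTheory.GaloisRepresentations.IsComplexConjugation φ c →
          (ρ c).val.trace = 0 ∨ (ρ c).val.trace = 1 ∨ (ρ c).val.trace = -1) →
      (∀ᶠ v : IsDedekindDomain.HeightOneSpectrum (NumberField.RingOfIntegers ℚ) in Filter.cofinite,
        ρ.IsUnramifiedAt v) →
      (∀ (v : IsDedekindDomain.HeightOneSpectrum (NumberField.RingOfIntegers ℚ))
        (hv : ((ℓ : ℕ) : NumberField.RingOfIntegers ℚ) ∈ v.asIdeal),
        (Literature.NumberTheory.PAdicHodge.fontainePstAdicCompletion v ℓ hv).IsDeRhamFramed (ρ.toLocal v) ∧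
        ∀ τ : v.adicCompletion ℚ →+* PadicAlgCl ℓ, Continuous τ →
          (ρ.labelledHodgeTateWeightsAt v
            (Literature.NumberTheory.PAdicHodge.fontainePstAdicCompletion v ℓ hv).algebra
            (Literature.NumberTheory.PAdicHodge.fontainePstAdicCompletion v ℓ hv).𝔅 τ).Nodup) →
      ∀ (hcpt : Literature.NumberTheory.Automorphic.isCompact_glFiniteIntegralLevel n ℚ)
        (ι : PadicAlgCl ℓ ≃+* ℂ),
        ∃ π : Literature.NumberTheory.Automorphic.CuspidalAutomorphicRepData n ℚ hcpt,
          π.1.IsLAlgebraic ∧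
          ∀ᶠ v : IsDedekindDomain.HeightOneSpectrum (NumberField.RingOfIntegers ℚ) in Filter.cofinite,
            Summit.Langlands.SatakeFrobCompatibleAt ι π.1 ρ v

/-- **THE RUNG** (the filed statement): the family at `n = 3`. -/
def OddRegularGaloisToAutomorphicQ3 : Prop := OddRegularGaloisToAutomorphicQ 3

section Floor

variable {A : Type*} [CommRing A] [IsDomain A] [CharZero A]

/-- A `2 × 2` involution of trace `0`, `1` or `-1` over a characteristic-zero domain has determinant
`-1` (and trace `0`).  [folklore: Cayley–Hamilton in rank 2] -/
theorem det_eq_neg_one_of_mul_self_eq_one (M : Matrix (Fin 2) (Fin 2) A) (hM : M * M = 1)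
    (htr : M.trace = 0 ∨ M.trace = 1 ∨ M.trace = -1) : M.det = -1 := by
  have h00 := congrFun (congrFun hM 0) 0
  have h01 := congrFun (congrFun hM 0) 1
  have h10 := congrFun (congrFun hM 1) 0
  have h11 := congrFun (congrFun hM 1) 1
  simp only [Matrix.mul_apply, Fin.sum_univ_two, Matrix.one_apply_eq, Matrix.one_apply_ne, ne_eq,
    Fin.zero_eq_one_iff, OfNat.ofNat_ne_one, not_false_eq_true,
    one_ne_zero] at h00 h01 h10 h11
  rw [Matrix.trace_fin_two] at htr
  rw [Matrix.det_fin_two]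
  rcases htr with h | h | h
  · have hd : M 1 1 = -M 0 0 := by linear_combination h
    rw [hd]
    linear_combination (-1 : A) * h00
  · exfalso
    have hb : M 0 1 = 0 := by
      have : M 0 1 * (M 0 0 + M 1 1) = 0 := by linear_combination h01
      simpa [h] using this
    have hc : M 1 0 = 0 := by
      have : M 1 0 * (M 0 0 + M 1 1) = 0 := by linear_combination h10
      simpa [h] using this
    have ha : M 0 0 * M 0 0 = 1 := by simpa [hb] using h00
    have hd : M 1 1 * M 1 1 = 1 := by simpa [hc] using h11
    have ha' : M 0 0 = 1 ∨ M 0 0 = -1 := by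
      have : (M 0 0 - 1) * (M 0 0 + 1) = 0 := by linear_combination ha
      rcases mul_eq_zero.mp this with h1 | h1
      · left; linear_combination h1
      · right; linear_combination h1
    have hd' : M 1 1 = 1 ∨ M 1 1 = -1 := by
      have : (M 1 1 - 1) * (M 1 1 + 1) = 0 := by linear_combination hd
      rcases mul_eq_zero.mp this with h1 | h1
      · left; linear_combination h1
      · right; linear_combination h1
    rcases ha' with ha' | ha' <;> rcases hd' with hd' | hd' <;> rw [ha', hd'] at h <;> norm_num at h
  · exfalso
    have hb : M 0 1 = 0 := by
      have : M 0 1 * (M 0 0 + M 1 1) = 0 := by linear_combination h01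
      simpa [h] using this
    have hc : M 1 0 = 0 := by
      have : M 1 0 * (M 0 0 + M 1 1) = 0 := by linear_combination h10
      simpa [h] using this
    have ha : M 0 0 * M 0 0 = 1 := by simpa [hb] using h00
    have hd : M 1 1 * M 1 1 = 1 := by simpa [hc] using h11
    have ha' : M 0 0 = 1 ∨ M 0 0 = -1 := by
      have : (M 0 0 - 1) * (M 0 0 + 1) = 0 := by linear_combination ha
      rcases mul_eq_zero.mp this with h1 | h1
      · left; linear_combination h1
      · right; linear_combination h1
    have hd' : M 1 1 = 1 ∨ M 1 1 = -1 := by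
      have : (M 1 1 - 1) * (M 1 1 + 1) = 0 := by linear_combination hd
      rcases mul_eq_zero.mp this with h1 | h1
      · left; linear_combination h1
      · right; linear_combination h1
    rcases ha' with ha' | ha' <;> rcases hd' with hd' | hd' <;> rw [ha', hd'] at h <;> norm_num at h

/-- Caraiani–Le Hung parity at `n = 2` is Serre's oddness `det ρ(c) = -1`. [folklore] -/
theorem isOdd_of_trace {ℓ : ℕ} [Fact ℓ.Prime]
    (ρ : Literature.NumberTheory.GaloisRepresentations.FramedGaloisRep ℚ (PadicAlgCl ℓ) 2)
    (h : ∀ (φ : ℚ →+* ℝ) (c : Field.absoluteGaloisGroup ℚ),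
      Literature.NumberTheory.GaloisRepresentations.IsComplexConjugation φ c →
        (ρ c).val.trace = 0 ∨ (ρ c).val.trace = 1 ∨ (ρ c).val.trace = -1) :
    ρ.IsOdd := by
  intro φ c hc
  have hsq : ρ c * ρ c = 1 := by
    rw [← sq, ← map_pow, hc.sq_eq_one, map_one]
  have hM : (ρ c).val * (ρ c).val = 1 := by
    simpa using congrArg Units.val hsq
  have hdet := det_eq_neg_one_of_mul_self_eq_one (ρ c).val hM (h φ c hc)
  ext
  simpa [Matrix.GeneralLinearGroup.val_det_apply] using hdet

/-- **The floor of the ladder**: the family at `n = 2` from the tree theorem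
`Theorems.oddPrimesRegularFM_of_XZhang2024_tateTwist` (item `DyadicOddResidue.OddPrimesRegularFM`).
[cite: XZhang2024FontaineMazurP3, Thm. 1.0.2] [cite: Pan2022, Thm. 1.0.4] [cite: Kisin2009, Thm. of the Introduction] -/
theorem floor_two (hXZ : XZhang2024_fontaineMazurGL2_tateTwist) : OddRegularGaloisToAutomorphicQ 2 := by
  intro ℓ _ hℓ ρ hirr hsign hunr hdR hcpt ι
  exact Summit.Langlands.Langlands.Theorems.oddPrimesRegularFM_of_XZhang2024_tateTwist hXZ ℓ hℓ ρ hirr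
    (isOdd_of_trace ρ hsign) hunr hdR hcpt ι

end Floor

/-- **F3 special-case instance**: the rung family at the floor parameter `n = 2` IS the floor
(tree theorem `oddPrimesRegularFM_of_XZhang2024_tateTwist`, through `floor_two`). -/
example (hXZ : XZhang2024_fontaineMazurGL2_tateTwist) : OddRegularGaloisToAutomorphicQ 2 := by
  simpa [OddRegularGaloisToAutomorphicQ] using floor_two hXZ

end Summit.Langlands.Langlands.Cruxes.ReciprocityUpToIrreducibility.OddRegularGaloisToAutomorphicQ3.Special

end
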